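import Summits.BirchSwinnertonDyer.BirchSwinnertonDyer.Theses.SemiOrdinaryEisensteinDescent
import Literature.NumberTheory.EllipticCurves.GrossZagierRankOneProofs
import Literature.NumberTheory.EllipticCurves.BSDHeegnerPointsGrossZagierProofs
import HarnessLib

/-!
# Frame binder economy on the SOED Kolyvagin column: at analytic rank one, «`L(E^{d_K},1) ≠ 0`» and «`y_K` non-torsion»
# are the same hypothesis modulo Gross–Zagier and modularity (crux Ko `WildKolyvaginUpperAtThree`, stmt-BirchSwinnertonDyer-20480,
# and crux of record J‴ `WildSigmaDivisibilityAtThreeMultiCarrier`, stmt-BirchSwinnertonDyer-25898; route `SemiOrdinaryEisensteinDescent`)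

Width seat `bsd-wall-soed-p2-w3` g9 (2026-08-28), `--supports stmt-BirchSwinnertonDyer-20480` (helper). Kernel record of the
hypothesis-mutation finding of the one-shot vet `bsd-vet-tk5j` g14 (item evidence #47 on 25898, file `W-g14.lean` §2, never
proposed by that seat): every frame of the column carries BOTH binders h₇ «`(W.quadraticTwist d_K).entireLFunction 1 ≠ 0`» and
h₉ «`¬ IsOfFinAddOrder P`» next to h₃ «`W.analyticRank = 1`» and h₈ «`P ↦ heegnerPointComplex Dt H`»; modulo the two named print
facts `gross_zagier N W K` (Gross–Zagier 1986, Thm. I.(6.3) with V.§2, the tree's `GrossZagierFormula`) and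
`hasEntireLFunction_rat` (modularity ⇒ `L(E′,s)` entire, used only for differentiability at `s = 1`) each of h₇, h₉ implies the
other: `L(E,1) = 0` at analytic rank one, so `L′(E/K,1) = L′(E,1)·L(E^{d_K},1)` (product rule, the tree's
`lDerivEK_eq_deriv_mul_of_entireLFunction_one_eq_zero`) with `L′(E,1) ≠ 0`
(`leadingLCoeff_eq_deriv_of_analyticRank_eq_one`), and `L′(E/K,1) ≠ 0 ⟺ P` non-torsion for a Heegner point `P`
(`lDerivEK_ne_zero_iff_not_isOfFinAddOrder`, Gross 1991 (1.1)).

WHAT IS PROVED (theorems only; no definition, no named fact, no `sorry`; standard axioms):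
* §1 (route-independent frame lemmas) `twistL_one_ne_zero_of_not_isOfFinAddOrder`, `not_isOfFinAddOrder_of_twistL_one_ne_zero`,
  `twistL_one_ne_zero_iff_not_isOfFinAddOrder` — on a frame `(W, N, K, Dt, H, ι, P)` with `r_an(E) = 1`, `K` imaginary quadratic
  and Heegner for `N`, `P ↦ y_K`: h₇ ⟺ h₉ modulo `{gross_zagier N W K, hasEntireLFunction_rat}`.
* §2 (the column's cruxes, CONDITIONAL on the same two facts, nothing asserted about any curve) `wildKolyvaginUpperAtThree_noTwistL_of`
  / `wildKolyvaginUpperAtThree_noNonTorsion_of`: Ko ⟹ Ko's text with h₇ (resp. h₉) DELETED; `wildSigmaDivisibilityAtThreeMultiCarrier_noTwistL_of`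
  / `wildSigmaDivisibilityAtThreeMultiCarrier_noNonTorsion_of`: the same for J‴. The converse implications are weakenings
  (one `fun` each, not spelled out). Deleting BOTH binders is a different statement (frames with `r_an(E/K) = 3` and torsion
  `y_K`) and is NOT certified here.
READING for the pen (0 ask): exactly ONE of h₇/h₉ is decoration on every Ko/Ko′/J/J′/J‴ frame modulo print the route already
cites (`PublishedInputsWildThree` carries `gross_zagier` and `hasEntireLFunction_rat`); no restate is requested — the binders are
kept verbatim across the lineage so that closers plug by `fun`. HONEST FRAMING: nothing here proves Ko, J‴ or any case of BSD; the
research content of the column (Büyükboduk 2009 §4.2 Q1 at the additive prime 3 ⊕ Manin₃) is untouched.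

References: [GrossZagier1986] Thm. I.(6.3), V.§1 (p. 308: `L′(f,1)L_ε(f,1) = L′(f,1,1)`), V.§2; [Gross1991] (1.1);
[BCDTJAMS2001] Thm. A (modularity ⇒ continuation).
-/

set_option autoImplicit false
set_option linter.dupNamespace false -- `Summit.BirchSwinnertonDyer.BirchSwinnertonDyer.…` is the tree's layout (D-0017)

noncomputable section

open scoped Classical

namespace Summit.BirchSwinnertonDyer.BirchSwinnertonDyer.Theorems.WildKolyvaginUpperAtThreeFrameBinderEconomy

open WeierstrassCurve NumberField Literature.NumberTheory.EllipticCurves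
  Literature.NumberTheory.EllipticCurves.ModularForms
  Summit.BirchSwinnertonDyer.Rank1Residual Summit.BirchSwinnertonDyer.Rank1Residual.Additive
  Summit.BirchSwinnertonDyer.Rank1Residual.X11b.Three
  Summit.BirchSwinnertonDyer.BirchSwinnertonDyer.Theses.SemiOrdinaryEisensteinDescent

/-! ## §1 Frame lemmas: h₇ ⟺ h₉ at analytic rank one, modulo Gross–Zagier and modularity -/

section Frame

variable {W : WeierstrassCurve ℚ} [W.IsElliptic] {N : ℕ} [NeZero N] {K : Type} [Field K] [NumberField K]

/-- **h₃ ∧ h₉ ⟹ h₇ modulo {Gross–Zagier, modularity}.** On a frame with `ord_{s=1} L(E,s) = 1`, `K` imaginary quadratic and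
Heegner for `N`, `P ↦ y_K` the Heegner point and `P` of infinite order, the twisted central value `L(E^{d_K},1)` is non-zero:
`L(E,1) = 0`, so `L′(E/K,1) = L′(E,1)·L(E^{d_K},1)` (product rule on `LDerivEK`, both factors entire), and `L′(E/K,1) ≠ 0`
because `P` is non-torsion (Gross–Zagier). [cite: GrossZagier1986, Thm. I.(6.3), V.§1 (p. 308) and V.§2] [cite: Gross1991, (1.1)] -/
theorem twistL_one_ne_zero_of_not_isOfFinAddOrder (hGZ : gross_zagier N W K) (hmod : hasEntireLFunction_rat)
    (Dt : ModularParametrizationData W N) (H : HeegnerDatum N (NumberField.discr K)) (ι : K →+* ℂ)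
    (P : (W.baseChange K).toAffine.Point) (hr : W.analyticRank = 1) (hK : IsImaginaryQuadratic K)
    (hHH : SatisfiesHeegnerHypothesis N K)
    (hP : WeierstrassCurve.Affine.Point.map ι.toRatAlgHom P = heegnerPointComplex Dt H) (hnt : ¬ IsOfFinAddOrder P) :
    (W.quadraticTwist (NumberField.discr K : ℚ)).entireLFunction 1 ≠ 0 := by
  intro hLd
  have hHP : IsHeegnerPoint N W K P := ⟨Dt, H, ι, hP⟩
  have hne : LDerivEK W K ≠ 0 := (lDerivEK_ne_zero_iff_not_isOfFinAddOrder W N K hGZ hK hHH hHP).mpr hnt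
  have hprod := lDerivEK_eq_deriv_mul_of_entireLFunction_one_eq_zero hmod W K
    (entireLFunction_one_eq_zero_of_analyticRank_eq_one hr)
  rw [hLd, mul_zero] at hprod
  exact hne hprod

/-- **h₃ ∧ h₇ ⟹ h₉ modulo {Gross–Zagier, modularity}.** Conversely, at analytic rank one `L′(E,1) ≠ 0`, so
`L′(E/K,1) = L′(E,1)·L(E^{d_K},1) ≠ 0` as soon as `L(E^{d_K},1) ≠ 0`, and then the Heegner point `P` has infinite order
(Gross–Zagier). [cite: GrossZagier1986, Thm. I.(6.3), V.§1 (p. 308) and V.§2] [cite: Gross1991, (1.1)] -/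
theorem not_isOfFinAddOrder_of_twistL_one_ne_zero (hGZ : gross_zagier N W K) (hmod : hasEntireLFunction_rat)
    (Dt : ModularParametrizationData W N) (H : HeegnerDatum N (NumberField.discr K)) (ι : K →+* ℂ)
    (P : (W.baseChange K).toAffine.Point) (hr : W.analyticRank = 1) (hK : IsImaginaryQuadratic K)
    (hHH : SatisfiesHeegnerHypothesis N K)
    (hP : WeierstrassCurve.Affine.Point.map ι.toRatAlgHom P = heegnerPointComplex Dt H)
    (hLd : (W.quadraticTwist (NumberField.discr K : ℚ)).entireLFunction 1 ≠ 0) : ¬ IsOfFinAddOrder P := by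
  have hHP : IsHeegnerPoint N W K P := ⟨Dt, H, ι, hP⟩
  refine (lDerivEK_ne_zero_iff_not_isOfFinAddOrder W N K hGZ hK hHH hHP).mp ?_
  rw [lDerivEK_eq_deriv_mul_of_entireLFunction_one_eq_zero hmod W K
    (entireLFunction_one_eq_zero_of_analyticRank_eq_one hr)]
  exact mul_ne_zero (leadingLCoeff_eq_deriv_of_analyticRank_eq_one hr).2 hLd

/-- **h₇ ⟺ h₉ on a Heegner frame at analytic rank one**, modulo {Gross–Zagier, modularity}: `L(E^{d_K},1) ≠ 0 ↔ y_K` has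
infinite order. [cite: GrossZagier1986, Thm. I.(6.3), V.§1 (p. 308) and V.§2] [cite: Gross1991, (1.1)] -/
theorem twistL_one_ne_zero_iff_not_isOfFinAddOrder (hGZ : gross_zagier N W K) (hmod : hasEntireLFunction_rat)
    (Dt : ModularParametrizationData W N) (H : HeegnerDatum N (NumberField.discr K)) (ι : K →+* ℂ)
    (P : (W.baseChange K).toAffine.Point) (hr : W.analyticRank = 1) (hK : IsImaginaryQuadratic K)
    (hHH : SatisfiesHeegnerHypothesis N K)
    (hP : WeierstrassCurve.Affine.Point.map ι.toRatAlgHom P = heegnerPointComplex Dt H) :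
    (W.quadraticTwist (NumberField.discr K : ℚ)).entireLFunction 1 ≠ 0 ↔ ¬ IsOfFinAddOrder P :=
  ⟨not_isOfFinAddOrder_of_twistL_one_ne_zero hGZ hmod Dt H ι P hr hK hHH hP,
    twistL_one_ne_zero_of_not_isOfFinAddOrder hGZ hmod Dt H ι P hr hK hHH hP⟩

end Frame

/-! ## §2 The column's cruxes with one binder deleted (conditional on the same two named facts) -/

/-- **Ko ⟹ Ko without h₇** (modulo {Gross–Zagier, modularity}): from `WildKolyvaginUpperAtThree` (stmt-BirchSwinnertonDyer-20480) the
same conclusion on every frame WITHOUT the binder `L(E^{d_K},1) ≠ 0` — it is recovered from `r_an(E) = 1` and the non-torsion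
Heegner point by `twistL_one_ne_zero_of_not_isOfFinAddOrder`. CONDITIONAL; nothing is asserted about any curve.
[cite: GrossZagier1986, Thm. I.(6.3) and V.§2] -/
theorem wildKolyvaginUpperAtThree_noTwistL_of
    (hGZ : ∀ (N : ℕ) [NeZero N] (W : WeierstrassCurve ℚ) (K : Type) [Field K] [NumberField K], gross_zagier N W K)
    (hmod : hasEntireLFunction_rat) (hKo : WildKolyvaginUpperAtThree) :
    ∀ (W : WeierstrassCurve ℚ) [W.IsElliptic] [W.IsGloballyMinimal] (N : ℕ) [NeZero N] (K : Type) [Field K] [NumberField K]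
      (Dt : ModularParametrizationData W N) (H : HeegnerDatum N (NumberField.discr K)) (ι : K →+* ℂ)
      (P : (W.baseChange K).toAffine.Point),
      ClassO6 W 3 → W.HasSurjectiveModNGaloisRep 3 → W.analyticRank = 1 → W.conductorNorm ℤ = N →
      IsImaginaryQuadratic K → SatisfiesHeegnerHypothesis N K →
      WeierstrassCurve.Affine.Point.map ι.toRatAlgHom P = heegnerPointComplex Dt H →
      ¬ IsOfFinAddOrder P → Odd (NumberField.discr K) → NumberField.discr K ≠ -3 →
      AdditiveThree.TowerSurjThree W → SchneiderFree.Upper.IndexUpperBoundLeAt W 3 K P (padicValNat 3 Dt.c.natAbs) := by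
  intro W _ _ N _ K _ _ Dt H ι P hO6 hsurj hr hN hK hHH hP hnt hodd h3 htow
  exact hKo W N K Dt H ι P hO6 hsurj hr hN hK hHH
    (twistL_one_ne_zero_of_not_isOfFinAddOrder (hGZ N W K) hmod Dt H ι P hr hK hHH hP hnt) hP hnt hodd h3 htow

/-- **Ko ⟹ Ko without h₉** (modulo {Gross–Zagier, modularity}): from `WildKolyvaginUpperAtThree` the same conclusion on every frame
WITHOUT the binder `¬ IsOfFinAddOrder P` — it is recovered from `r_an(E) = 1` and `L(E^{d_K},1) ≠ 0` by
`not_isOfFinAddOrder_of_twistL_one_ne_zero`. CONDITIONAL; nothing is asserted about any curve.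
[cite: GrossZagier1986, Thm. I.(6.3) and V.§2] -/
theorem wildKolyvaginUpperAtThree_noNonTorsion_of
    (hGZ : ∀ (N : ℕ) [NeZero N] (W : WeierstrassCurve ℚ) (K : Type) [Field K] [NumberField K], gross_zagier N W K)
    (hmod : hasEntireLFunction_rat) (hKo : WildKolyvaginUpperAtThree) :
    ∀ (W : WeierstrassCurve ℚ) [W.IsElliptic] [W.IsGloballyMinimal] (N : ℕ) [NeZero N] (K : Type) [Field K] [NumberField K]
      (Dt : ModularParametrizationData W N) (H : HeegnerDatum N (NumberField.discr K)) (ι : K →+* ℂ)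
      (P : (W.baseChange K).toAffine.Point),
      ClassO6 W 3 → W.HasSurjectiveModNGaloisRep 3 → W.analyticRank = 1 → W.conductorNorm ℤ = N →
      IsImaginaryQuadratic K → SatisfiesHeegnerHypothesis N K →
      (W.quadraticTwist (NumberField.discr K : ℚ)).entireLFunction 1 ≠ 0 →
      WeierstrassCurve.Affine.Point.map ι.toRatAlgHom P = heegnerPointComplex Dt H →
      Odd (NumberField.discr K) → NumberField.discr K ≠ -3 →
      AdditiveThree.TowerSurjThree W → SchneiderFree.Upper.IndexUpperBoundLeAt W 3 K P (padicValNat 3 Dt.c.natAbs) := by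
  intro W _ _ N _ K _ _ Dt H ι P hO6 hsurj hr hN hK hHH hLd hP hodd h3 htow
  exact hKo W N K Dt H ι P hO6 hsurj hr hN hK hHH hLd hP
    (not_isOfFinAddOrder_of_twistL_one_ne_zero (hGZ N W K) hmod Dt H ι P hr hK hHH hP hLd) hodd h3 htow

/-- **J‴ ⟹ J‴ without h₇** (modulo {Gross–Zagier, modularity}): from `WildSigmaDivisibilityAtThreeMultiCarrier`
(stmt-BirchSwinnertonDyer-25898) the same σ-divisibility conclusion on every multi-carrier frame WITHOUT the binder
`L(E^{d_K},1) ≠ 0`. CONDITIONAL; nothing is asserted about any curve. [cite: GrossZagier1986, Thm. I.(6.3) and V.§2] -/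
theorem wildSigmaDivisibilityAtThreeMultiCarrier_noTwistL_of
    (hGZ : ∀ (N : ℕ) [NeZero N] (W : WeierstrassCurve ℚ) (K : Type) [Field K] [NumberField K], gross_zagier N W K)
    (hmod : hasEntireLFunction_rat) (hJ : WildSigmaDivisibilityAtThreeMultiCarrier) :
    ∀ (W : WeierstrassCurve ℚ) [W.IsElliptic] [W.IsGloballyMinimal] (N : ℕ) [NeZero N] (K : Type) [Field K] [NumberField K]
      (Dt : ModularParametrizationData W N) (H : HeegnerDatum N (NumberField.discr K)) (ι : K →+* ℂ)
      (P : (W.baseChange K).toAffine.Point),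
      ClassO6 W 3 → W.HasSurjectiveModNGaloisRep 3 → W.analyticRank = 1 → W.conductorNorm ℤ = N →
      IsImaginaryQuadratic K → SatisfiesHeegnerHypothesis N K →
      WeierstrassCurve.Affine.Point.map ι.toRatAlgHom P = heegnerPointComplex Dt H →
      ¬ IsOfFinAddOrder P → Odd (NumberField.discr K) → NumberField.discr K ≠ -3 →
      (∀ (q : ℕ) [Fact q.Prime], q ∣ N →
        padicValNat 3 ((W.baseChange ℚ_[q]).localTamagawaNumber ℤ_[q]) <
          padicValNat 3 W.tamagawaProduct + padicValNat 3 Dt.c.natAbs) →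
      ∀ (s' : ℕ), s' ≤ padicValNat 3 W.tamagawaProduct + padicValNat 3 Dt.c.natAbs →
        ∀ (n : ℕ) (d : KolyvaginHeegnerData Dt H.β ι n), Squarefree n →
          (∀ ℓ ∈ n.primeFactors, Zhang2014.IsKolyvaginPrime N W K 3 ℓ ∧ s' ≤ Zhang2014.kolyvaginIndex W 3 ℓ) →
          Koly.PDiv d 3 s' := by
  intro W _ _ N _ K _ _ Dt H ι P hO6 hsurj hr hN hK hHH hP hnt hodd h3 hcut
  exact hJ W N K Dt H ι P hO6 hsurj hr hN hK hHH
    (twistL_one_ne_zero_of_not_isOfFinAddOrder (hGZ N W K) hmod Dt H ι P hr hK hHH hP hnt) hP hnt hodd h3 hcut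

/-- **J‴ ⟹ J‴ without h₉** (modulo {Gross–Zagier, modularity}): from `WildSigmaDivisibilityAtThreeMultiCarrier` the same
σ-divisibility conclusion on every multi-carrier frame WITHOUT the binder `¬ IsOfFinAddOrder P`. CONDITIONAL; nothing is
asserted about any curve. [cite: GrossZagier1986, Thm. I.(6.3) and V.§2] -/
theorem wildSigmaDivisibilityAtThreeMultiCarrier_noNonTorsion_of
    (hGZ : ∀ (N : ℕ) [NeZero N] (W : WeierstrassCurve ℚ) (K : Type) [Field K] [NumberField K], gross_zagier N W K)
    (hmod : hasEntireLFunction_rat) (hJ : WildSigmaDivisibilityAtThreeMultiCarrier) :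
    ∀ (W : WeierstrassCurve ℚ) [W.IsElliptic] [W.IsGloballyMinimal] (N : ℕ) [NeZero N] (K : Type) [Field K] [NumberField K]
      (Dt : ModularParametrizationData W N) (H : HeegnerDatum N (NumberField.discr K)) (ι : K →+* ℂ)
      (P : (W.baseChange K).toAffine.Point),
      ClassO6 W 3 → W.HasSurjectiveModNGaloisRep 3 → W.analyticRank = 1 → W.conductorNorm ℤ = N →
      IsImaginaryQuadratic K → SatisfiesHeegnerHypothesis N K →
      (W.quadraticTwist (NumberField.discr K : ℚ)).entireLFunction 1 ≠ 0 →
      WeierstrassCurve.Affine.Point.map ι.toRatAlgHom P = heegnerPointComplex Dt H →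
      Odd (NumberField.discr K) → NumberField.discr K ≠ -3 →
      (∀ (q : ℕ) [Fact q.Prime], q ∣ N →
        padicValNat 3 ((W.baseChange ℚ_[q]).localTamagawaNumber ℤ_[q]) <
          padicValNat 3 W.tamagawaProduct + padicValNat 3 Dt.c.natAbs) →
      ∀ (s' : ℕ), s' ≤ padicValNat 3 W.tamagawaProduct + padicValNat 3 Dt.c.natAbs →
        ∀ (n : ℕ) (d : KolyvaginHeegnerData Dt H.β ι n), Squarefree n →
          (∀ ℓ ∈ n.primeFactors, Zhang2014.IsKolyvaginPrime N W K 3 ℓ ∧ s' ≤ Zhang2014.kolyvaginIndex W 3 ℓ) →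
          Koly.PDiv d 3 s' := by
  intro W _ _ N _ K _ _ Dt H ι P hO6 hsurj hr hN hK hHH hLd hP hodd h3 hcut
  exact hJ W N K Dt H ι P hO6 hsurj hr hN hK hHH hLd hP
    (not_isOfFinAddOrder_of_twistL_one_ne_zero (hGZ N W K) hmod Dt H ι P hr hK hHH hP hLd) hodd h3 hcut

end Summit.BirchSwinnertonDyer.BirchSwinnertonDyer.Theorems.WildKolyvaginUpperAtThreeFrameBinderEconomy

end
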